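import Summits.QuantumFields.YangMills.Theses.TransportPerturbation

/-!
# Route `TransportPerturbation` — support `DiscrepancyBounds` (stmt-QuantumFields-26990): `0 ≤ wd_K(u,v) ≤ 4`

Seat `ym-line-sfw-p1` g12 (2026-08-28).  Rung R3 is a RECORD-label rung (leaf `YM3TorusSU2`), not the Clay mass gap; this module is
elementary bookkeeping and proves no step of any renormalisation-group argument.

`wd_K(u,v) = Σ_{j ≤ K} L^{−(K−j)} · inf_h sup_{p, a, b} |(Ū^j(u)_p)_{ab} − ((h·Ū^j(v))_p)_{ab}|` — the scale-weighted gauge-invariant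
discrepancy of two step-`K` configurations through their Bałaban block averages (written inline in the route file).  Entries of `SU(2)`
matrices have norm `≤ 1` (Mathlib `entry_norm_bound_of_unitary`), so every `sup` lies in `[0, 2]`, every `inf` too (the identity gauge
transformation is a competitor; all terms are `≥ 0`), and `Σ_{j ≤ K} L^{−(K−j)} ≤ 1/(1 − 1/L) ≤ 2` for `L ≥ 2` (a `T3Family` has odd
`L > 1`).  `discrepancyBounds_proof : DiscrepancyBounds` BY NAME.  No definitions, no named facts, no `sorry`.
-/

set_option autoImplicit false

noncomputable section

namespace Summit.QuantumFields.YangMills.Theorems.TransportPerturbation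

/-- The reversed scale weights sum to at most `2`: `Σ_{j ≤ K} (1/L)^{K−j} = Σ_{i ≤ K} (1/L)^i ≤ 1/(1 − 1/L) ≤ 2` for `L ≥ 2`. [folklore] -/
theorem sum_range_inv_pow_rev_le_two (L K : ℕ) (hL : 2 ≤ L) :
    ∑ j ∈ Finset.range (K + 1), ((L : ℝ)⁻¹) ^ (K - j) ≤ 2 := by
  set r : ℝ := ((L : ℝ)⁻¹) with hr
  have hL' : (2 : ℝ) ≤ L := by exact_mod_cast hL
  have hLpos : (0 : ℝ) < L := by linarith
  have hr0 : 0 ≤ r := inv_nonneg.mpr hLpos.le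
  have hr2 : r ≤ 1 / 2 := by
    rw [hr, inv_eq_one_div]
    exact one_div_le_one_div_of_le (by norm_num) hL'
  have hrefl := Finset.sum_range_reflect (fun i => r ^ i) (K + 1)
  simp only [Nat.add_sub_cancel] at hrefl
  rw [hrefl]
  -- `(Σ_{i ≤ K} r^i)(1 − r) = 1 − r^{K+1} ≤ 1` and `1 − r ≥ 1/2`
  have h1 : 0 < 1 - r := by linarith
  have hgeom : (∑ i ∈ Finset.range (K + 1), r ^ i) * (1 - r) ≤ 1 := by
    rw [geom_sum_mul_neg]
    have : 0 ≤ r ^ (K + 1) := pow_nonneg hr0 _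
    linarith
  have hsum0 : 0 ≤ ∑ i ∈ Finset.range (K + 1), r ^ i := Finset.sum_nonneg fun i _ => pow_nonneg hr0 i
  nlinarith

/-- ★ **`DiscrepancyBounds` (stmt-QuantumFields-26990)** BY NAME: `0 ≤ wd_K(u,v) ≤ 4` for all step-`K` configurations `u, v` of every
family (entries of `SU(2)` matrices have norm `≤ 1`; the identity gauge transformation bounds each infimum by its supremum `≤ 2`;
geometric series in `1/L ≤ 1/2`). [cite: Balaban1985UV3, (4) p.256] -/
theorem discrepancyBounds_proof : Summit.QuantumFields.YangMills.Theses.TransportPerturbation.DiscrepancyBounds := by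
  intro F K u v
  have hL2 : 2 ≤ F.L := F.hL.2
  have hc : ∀ j : ℕ, (0 : ℝ) ≤ ((F.L : ℝ)⁻¹) ^ (K - j) := fun j => pow_nonneg (inv_nonneg.mpr (Nat.cast_nonneg _)) _
  constructor
  · exact Finset.sum_nonneg fun j _ =>
      mul_nonneg (hc j) (Real.iInf_nonneg fun h => Real.iSup_nonneg fun p => norm_nonneg _)
  · refine (Finset.sum_le_sum fun j _ => mul_le_mul_of_nonneg_left (?_ : _ ≤ (2 : ℝ)) (hc j)).trans ?_
    · -- `inf_h sup_p ‖a − b‖ ≤ sup_p ‖a − b‖ at h = 1 ≤ 2`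
      refine ciInf_le_of_le ⟨0, ?_⟩ (fun _ => 1) (Real.iSup_le (fun p => ?_) (by norm_num))
      · rintro _ ⟨h, rfl⟩
        exact Real.iSup_nonneg fun p => norm_nonneg _
      · refine (norm_sub_le _ _).trans ?_
        have h1 := entry_norm_bound_of_unitary
          (Subtype.prop (Literature.MathematicalPhysics.QuantumFieldTheory.Balaban1983to89.Averaging.iter
            (fun i => Literature.MathematicalPhysics.QuantumFieldTheory.Balaban1983to89.BlockAveraging.blockAvg (P := F.P K) (j := i)
              (Literature.MathematicalPhysics.QuantumFieldTheory.Balaban1983to89.ExpMeanLog.expMeanLogSU :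
                Literature.MathematicalPhysics.QuantumFieldTheory.Balaban1983to89.LoopAverage (Matrix.specialUnitaryGroup (Fin 2) ℂ)))
            j (fun b : Literature.MathematicalPhysics.QuantumFieldTheory.Balaban1983to89.PBond (F.P K) 0 => u (b.src, b.dir)) p.1)).1
          p.2.1 p.2.2
        have h2 := entry_norm_bound_of_unitary
          (Subtype.prop (Literature.MathematicalPhysics.QuantumFieldTheory.Balaban1983to89.GaugeField.gaugeAct
            (fun _ => (1 : Matrix.specialUnitaryGroup (Fin 2) ℂ))
            (Literature.MathematicalPhysics.QuantumFieldTheory.Balaban1983to89.Averaging.iter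
              (fun i => Literature.MathematicalPhysics.QuantumFieldTheory.Balaban1983to89.BlockAveraging.blockAvg (P := F.P K) (j := i)
                (Literature.MathematicalPhysics.QuantumFieldTheory.Balaban1983to89.ExpMeanLog.expMeanLogSU :
                  Literature.MathematicalPhysics.QuantumFieldTheory.Balaban1983to89.LoopAverage (Matrix.specialUnitaryGroup (Fin 2) ℂ)))
              j (fun b : Literature.MathematicalPhysics.QuantumFieldTheory.Balaban1983to89.PBond (F.P K) 0 => v (b.src, b.dir))) p.1)).1
          p.2.1 p.2.2
        linarith
    · rw [← Finset.sum_mul]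
      have h := sum_range_inv_pow_rev_le_two F.L K hL2
      linarith

end Summit.QuantumFields.YangMills.Theorems.TransportPerturbation

end
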